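import Literature.Analysis.FluidPDE.SereginZajaczkowski2007L42Vorticity
import Literature.Analysis.FluidPDE.SereginZajaczkowski2007L42VorticityProofs
import Literature.Analysis.FluidPDE.SereginZajaczkowski2007L42VorticityEnergy
import HarnessLib

/-!
# Seregin–Zajaczkowski (2007), proof of Lemma 4.2, first half (the off-axis vorticity bound) — discharged

Analysis/FluidPDE glue file **discharging the named fact
`Literature.Analysis.FluidPDE.SereginZajaczkowski2007.OffAxisVorticityL2Bound`**
(`SereginZajaczkowski2007L42.lean`; G. Seregin, W. Zajaczkowski, *A sufficient condition of
regularity for axially symmetric solutions to the Navier–Stokes equations*, SIAM J. Math. Anal.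
39 (2007), proof of Lemma 4.2, (4.5)–(4.13): "`‖χ̃‖_{L_{2,∞}(Q̃)} ≤ Φ₃(𝒜₂)`" for the cut-off
angular vorticity `χ̃ = ω_φ ψ` away from the axis). The accepted tree reduction is
`SereginZajaczkowski2007.offAxisVorticityL2Bound_of` (`SereginZajaczkowski2007L42Vorticity.lean`,
from the angular vorticity equation (4.5) and the localized energy inequality (4.9)–(4.13)), and
both inputs are discharged (`AngularVorticityEquation_holds`,
`SereginZajaczkowski2007L42VorticityProofs.lean`; `LocalizedVorticityEnergyInequality_holds`,
`SereginZajaczkowski2007L42VorticityEnergy.lean`).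

Theorem-only glue module: no definitions, no named facts, no `sorry`; the theorem is a
composition of an accepted tree reduction with accepted discharges (pure proof of an
unchanged statement).

## References

* G. Seregin, W. Zajaczkowski, *A sufficient condition of regularity for axially symmetric
  solutions to the Navier–Stokes equations*, SIAM J. Math. Anal. 39 (2007) 669–685, Lemma 4.2 and
  its proof, (4.5)–(4.13). [SereginZajaczkowski2007]
-/

noncomputable section

namespace Literature.Analysis.FluidPDE

namespace SereginZajaczkowski2007

/-- **Seregin–Zajaczkowski 2007, proof of Lemma 4.2, first half (the vorticity bound
`‖χ̃‖_{L_{2,∞}(Q̃)} ≤ Φ₃(𝒜₂)`), proved** (the named statement `OffAxisVorticityL2Bound`), by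
`offAxisVorticityL2Bound_of`, `AngularVorticityEquation_holds` and
`LocalizedVorticityEnergyInequality_holds`. [cite: SereginZajaczkowski2007, proof of Lemma 4.2 ((4.5)–(4.13))] -/
theorem OffAxisVorticityL2Bound_holds : OffAxisVorticityL2Bound :=
  offAxisVorticityL2Bound_of AngularVorticityEquation_holds LocalizedVorticityEnergyInequality_holds

end SereginZajaczkowski2007

end Literature.Analysis.FluidPDE

end
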